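import Summits.AtomisticToContinuum.BoseEinsteinCondensation.Theses.BECStronglyRayleigh
import Summits.AtomisticToContinuum.BoseEinsteinCondensation.Theorems.InsertionFieldDelocalisation.Negative.Toolkit
import Summits.AtomisticToContinuum.BoseEinsteinCondensation.Theorems.InsertionFieldDelocalisation.Negative.Tightness
import Summits.AtomisticToContinuum.BoseEinsteinCondensation.Theorems.InsertionFieldDelocalisation.Negative.PerronExistence
import HarnessLib

/-!
# Stub `stub_logMeanDomination` (S3) of line `log-insertion-infrared-bound`,
crux `BECStronglyRayleigh.InsertionFieldDelocalisation` (stmt-AtomisticToContinuum-9673)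

Supports (does not close) stmt-AtomisticToContinuum-9673. The deterministic RE-CENTRING step of the
line: Perron–Frobenius positivity of the admissible amplitudes (`AmplitudePos`, first hypothesis) and the
`ω`-averaged centred third exponential moment of the log-insertion field (`LogInsertionExpMoment K`,
second hypothesis) imply the `ω`-averaged arithmetic-mean normalised third moment of the insertion field
(`NormalisedThirdMoment K`, conclusion) with the SAME constant `K`.

Proof: fix an admissible datum `(L, N, ψ)` and `T` with `|T| = N - 2`; write `r = field ψ T`,
`F = Tᶜ`, `n = |F|`, `R = Σ_y r_y = Σ_{y ∈ F} r_y` (`r = 0` on `T`), `ḡ = n⁻¹ Σ_{y ∈ F} log r_y`.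
* `r_x > 0` for `x ∈ F`: pick `y₀ ∈ F`, `y₀ ≠ x` (`n ≥ 2`), then
  `r_x ≥ Re ψ(1_{T ∪ {x, y₀}}) > 0` (`le_field` + positivity at the `N`-set `T ∪ {x, y₀}`).
* Jensen for the concave logarithm in its most elementary form (`log t ≤ t - 1` summed over `F`):
  `ḡ ≤ log (R / n)`, hence `e^{ḡ} ≤ R / n` and termwise `(n r_x / R)³ ≤ (r_x e^{-ḡ})³ = e^{3(log r_x - ḡ)}`.
* Multiply by `‖r‖² ≥ 0`, sum over `T`, and chain with the second hypothesis.
No eigen-equation is used beyond feeding the hypotheses.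
-/

noncomputable section

open scoped BigOperators
open Literature.MathematicalPhysics.QuantumLattice Literature.Probability.LatticeModels
open Summit.AtomisticToContinuum.BoseEinsteinCondensation.Theorems.InsertionFieldDelocalisation.Negative

set_option linter.dupNamespace false

namespace Summit.AtomisticToContinuum.BoseEinsteinCondensation.Cruxes.InsertionFieldDelocalisation.LogInsertionInfraredBound

/-- **Jensen for the logarithm, elementary form.** For reals `f > 0` on a nonempty finset `s`,
the mean of `log f` is at most the `log` of the mean of `f`:
`|s|⁻¹ Σ_{i ∈ s} log f_i ≤ log (|s|⁻¹ Σ_{i ∈ s} f_i)` (sum `log t ≤ t - 1` at `t = f_i / mean`). [folklore] -/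
theorem s3dom_sum_log_div_card_le {ι : Type*} (s : Finset ι) (hs : s.Nonempty) (f : ι → ℝ)
    (hf : ∀ i ∈ s, 0 < f i) :
    (∑ i ∈ s, Real.log (f i)) / (s.card : ℝ) ≤ Real.log ((∑ i ∈ s, f i) / (s.card : ℝ)) := by
  have hn : (0 : ℝ) < s.card := by exact_mod_cast hs.card_pos
  have hR : 0 < ∑ i ∈ s, f i := Finset.sum_pos hf hs
  set m := (∑ i ∈ s, f i) / (s.card : ℝ) with hm
  have hm0 : 0 < m := div_pos hR hn
  rw [div_le_iff₀ hn]
  have key : ∀ i ∈ s, Real.log (f i) ≤ Real.log m + (f i / m - 1) := by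
    intro i hi
    have h1 : Real.log (f i / m) ≤ f i / m - 1 :=
      Real.log_le_sub_one_of_pos (div_pos (hf i hi) hm0)
    rw [Real.log_div (hf i hi).ne' hm0.ne'] at h1
    linarith
  have hsum : (∑ i ∈ s, f i) / m = s.card := by
    rw [hm]
    field_simp
  calc ∑ i ∈ s, Real.log (f i) ≤ ∑ i ∈ s, (Real.log m + (f i / m - 1)) := Finset.sum_le_sum key
    _ = s.card * Real.log m + ((∑ i ∈ s, f i) / m - s.card) := by
        rw [Finset.sum_add_distrib, Finset.sum_const, nsmul_eq_mul, Finset.sum_sub_distrib,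
          Finset.sum_div, Finset.sum_const, nsmul_eq_mul, mul_one]
    _ = Real.log m * s.card := by
        rw [hsum]
        ring

/-- **Termwise domination of the arithmetic-mean normalisation by the log-mean centring.** For reals
`f > 0` on a finset `s ∋ x` (`n = |s|`, `R = Σ_s f`, `ḡ = n⁻¹ Σ_s log f`):
`(n f_x / R)³ ≤ exp (3 (log f_x - ḡ))`, because `e^{ḡ} ≤ R / n` (Jensen). [folklore] -/
theorem s3dom_term_le {ι : Type*} (s : Finset ι) (f : ι → ℝ) (hf : ∀ i ∈ s, 0 < f i) {x : ι}
    (hx : x ∈ s) :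
    ((s.card : ℝ) * f x / ∑ i ∈ s, f i) ^ 3 ≤
      Real.exp (3 * (Real.log (f x) - (∑ i ∈ s, Real.log (f i)) / (s.card : ℝ))) := by
  have hs : s.Nonempty := ⟨x, hx⟩
  have hn : (0 : ℝ) < s.card := by exact_mod_cast hs.card_pos
  have hR : 0 < ∑ i ∈ s, f i := Finset.sum_pos hf hs
  have hfx : 0 < f x := hf x hx
  set g := (∑ i ∈ s, Real.log (f i)) / (s.card : ℝ) with hg
  have hJ : g ≤ Real.log ((∑ i ∈ s, f i) / (s.card : ℝ)) := s3dom_sum_log_div_card_le s hs f hf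
  have hexpg : Real.exp g ≤ (∑ i ∈ s, f i) / (s.card : ℝ) := by
    have h := Real.exp_le_exp.mpr hJ
    rwa [Real.exp_log (div_pos hR hn)] at h
  have h3 : Real.exp (3 * (Real.log (f x) - g)) = (f x / Real.exp g) ^ 3 := by
    rw [show (3 : ℝ) * (Real.log (f x) - g) = ((3 : ℕ) : ℝ) * (Real.log (f x) - g) by norm_num,
      Real.exp_nat_mul, Real.exp_sub, Real.exp_log hfx]
  rw [h3]
  refine pow_le_pow_left₀ (by positivity) ?_ 3
  rw [div_le_div_iff₀ hR (Real.exp_pos g)]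
  calc (s.card : ℝ) * f x * Real.exp g
      ≤ (s.card : ℝ) * f x * ((∑ i ∈ s, f i) / (s.card : ℝ)) :=
        mul_le_mul_of_nonneg_left hexpg (mul_nonneg hn.le hfx.le)
    _ = f x * ∑ i ∈ s, f i := by
        field_simp

/-- **S3 · `stub_logMeanDomination` (card step (1b)).** Positivity + centred exponential moment of the
log field ⇒ arithmetic-mean normalised third moment, same constant: for `x ∈ Tᶜ`,
`r^T_x ≥ Re ψ(1_{T∪{x,y₀}}) > 0` (`le_field` + positivity, `|Tᶜ| ≥ 2`), and termwise
`(|Tᶜ| r_x / R_T)³ ≤ exp 3(log r_x − ḡ_T)` because `ḡ_T = avg_{Tᶜ} log r ≤ log avg_{Tᶜ} r = log (R_T/|Tᶜ|)`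
(Jensen; `R_T = Σ_{Tᶜ} r` as `r^T = 0` on `T`). [folklore] -/
theorem stub_logMeanDomination :
    ∀ K : ℝ,
      (∀ (L : ℕ) [NeZero L], 2 ≤ L → ∀ N : ℕ, 2 ≤ N → 2 * N ≤ L ^ 3 →
        ∀ ψ : TensorIndex (TorusSite 3 L) 2 → ℂ,
          ψ ∈ spinZSector 1 ((N : ℝ) - (L : ℝ) ^ 3 / 2) → ψ ≠ 0 →
          (xyTorus 3 L 1).mulVec ψ =
            ((lowestEnergyInSector 1 (xyTorus 3 L 1) ((N : ℝ) - (L : ℝ) ^ 3 / 2) : ℝ) : ℂ) • ψ →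
          (∀ σ, 0 ≤ (ψ σ).re ∧ (ψ σ).im = 0) →
          ∀ S : Finset (TorusSite 3 L), S.card = N → 0 < (ψ (fun x => if x ∈ S then 0 else 1)).re) →
      (∀ (L : ℕ) [NeZero L], 2 ≤ L → ∀ N : ℕ, 2 ≤ N → 2 * N ≤ L ^ 3 →
        ∀ ψ : TensorIndex (TorusSite 3 L) 2 → ℂ,
          ψ ∈ spinZSector 1 ((N : ℝ) - (L : ℝ) ^ 3 / 2) → ψ ≠ 0 →
          (xyTorus 3 L 1).mulVec ψ =
            ((lowestEnergyInSector 1 (xyTorus 3 L 1) ((N : ℝ) - (L : ℝ) ^ 3 / 2) : ℝ) : ℂ) • ψ →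
          (∀ σ, 0 ≤ (ψ σ).re ∧ (ψ σ).im = 0) →
          ∑ T ∈ (Finset.univ : Finset (TorusSite 3 L)).powersetCard (N - 2),
              K1rhs (field ψ T) *
                ((∑ x ∈ Tᶜ, Real.exp (3 * (Real.log (field ψ T x) -
                    (∑ y ∈ Tᶜ, Real.log (field ψ T y)) / (Tᶜ.card : ℝ)))) / (Tᶜ.card : ℝ)) ≤
            K * ∑ T ∈ (Finset.univ : Finset (TorusSite 3 L)).powersetCard (N - 2), K1rhs (field ψ T)) →
      (∀ (L : ℕ) [NeZero L], 2 ≤ L → ∀ N : ℕ, 2 ≤ N → 2 * N ≤ L ^ 3 →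
        ∀ ψ : TensorIndex (TorusSite 3 L) 2 → ℂ,
          ψ ∈ spinZSector 1 ((N : ℝ) - (L : ℝ) ^ 3 / 2) → ψ ≠ 0 →
          (xyTorus 3 L 1).mulVec ψ =
            ((lowestEnergyInSector 1 (xyTorus 3 L 1) ((N : ℝ) - (L : ℝ) ^ 3 / 2) : ℝ) : ℂ) • ψ →
          (∀ σ, 0 ≤ (ψ σ).re ∧ (ψ σ).im = 0) →
          ∑ T ∈ (Finset.univ : Finset (TorusSite 3 L)).powersetCard (N - 2),
              K1rhs (field ψ T) *
                ((∑ x ∈ Tᶜ, ((Tᶜ.card : ℝ) * field ψ T x / ∑ y, field ψ T y) ^ 3) / (Tᶜ.card : ℝ)) ≤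
            K * ∑ T ∈ (Finset.univ : Finset (TorusSite 3 L)).powersetCard (N - 2), K1rhs (field ψ T)) := by
  intro K hpos hexp L _ hL N hN hNL ψ hsec hne heig hnn
  refine le_trans (Finset.sum_le_sum fun T hT => ?_) (hexp L hL N hN hNL ψ hsec hne heig hnn)
  have hψre : ∀ σ, 0 ≤ (ψ σ).re := fun σ => (hnn σ).1
  have hTcard : T.card = N - 2 := (Finset.mem_powersetCard.mp hT).2
  -- positivity of the insertion field on the free sites
  have hfpos : ∀ x ∈ Tᶜ, 0 < field ψ T x := by
    intro x hx
    have hxT : x ∉ T := Finset.mem_compl.mp hx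
    have hcc : 1 < Tᶜ.card := by
      rw [Finset.card_compl, hTcard]
      have hcard : Fintype.card (TorusSite 3 L) = L ^ 3 := by
        simp [Fintype.card_pi, ZMod.card]
      rw [hcard]
      omega
    obtain ⟨y, hy, hyx⟩ := Finset.exists_mem_ne hcc x
    have hyT : y ∉ T := Finset.mem_compl.mp hy
    have hS : (insert x (insert y T)).card = N := by
      rw [Finset.card_insert_of_notMem, Finset.card_insert_of_notMem hyT, hTcard]
      · omega
      · simp [hxT, hyx.symm]
    exact lt_of_lt_of_le (hpos L hL N hN hNL ψ hsec hne heig hnn _ hS)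
      (le_field ψ hψre T hxT hyT hyx.symm)
  -- the insertion field vanishes on `T`, so `R_T = Σ_{Tᶜ} r`
  have hsum : ∑ y, field ψ T y = ∑ y ∈ Tᶜ, field ψ T y := by
    rw [← Finset.sum_subset (Finset.subset_univ Tᶜ)]
    intro y _ hy
    exact field_eq_zero_of_mem ψ T (by simpa using hy)
  refine mul_le_mul_of_nonneg_left ?_ (by rw [K1rhs]; exact Finset.sum_nonneg fun x _ => sq_nonneg _)
  refine div_le_div_of_nonneg_right (Finset.sum_le_sum fun x hx => ?_) (Nat.cast_nonneg _)
  rw [hsum]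
  exact s3dom_term_le Tᶜ (field ψ T) hfpos hx

end Summit.AtomisticToContinuum.BoseEinsteinCondensation.Cruxes.InsertionFieldDelocalisation.LogInsertionInfraredBound
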